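import Summits.QuantumFields.BalabanUV.T4Continuum.Support.VectorLineTransportUpperBound
import Summits.QuantumFields.BalabanUV.T4Continuum.Support.VariationalVectorInterpolant

/-!
# T⁴ programme, spine node NE2 (U1a), lane P2 — SUPPLIER LEAF V-UB FOR LINE-INDEXED TRANSPORTS AT FRAME-ADAPTED DATA («V-UB-L», part 3):
# THE (1.18) LINE-AVERAGE CONSTRAINT IS MET EXACTLY BY THE TILTED TRIAL 1-FORM UNDER FRAME-ADAPTED LINE TRANSPORTS, AND THE NEAR-FRAME REPAIR

NE2 formalisation swarm `b2b-balaban-t4-ne2-formalise-*`, leaf prover 03 GEN 4 (`prover-b2b-balaban-t4-ne2-formalise-leaf-03-g4-0`); sequel of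
`VectorLineTransport` (p216509: `QvL`, `Kdef`, `QvL_compV_eq`) and `VectorLineTransportUpperBound` (p218278: `exists_corrected`, `exists_ubV_line_ScV`),
answering the cross-read remark on p218278 (journal `CLAIMS.log` 2026-08-20 ≈13:40Z, leaf-04-g4): the bond-indexed reference `S₀` of the relative binder
`‖T(y,j,t,μ)∘S₀(p,μ) − 1‖ ≤ γ` is a small-field GAUGE condition at curved data — for leaf-01-g6's FRAME-ADAPTED line transports
`frameT U′ Rc` (`VariationalVectorInterpolant`, p219088: `U′(p)` at own-block points of the line, `Rc(y,μ)∘U′(p)` at its spill points) and `S₀ := U′⋆` one has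
`frameT∘U′⋆ − 1 = 0` on own-block points but `= Rc(y,μ) − 1` on spill points, which is not small.

THE POINT (this file).  `Rc(y,μ) − 1` is CONSTANT along the spill part of every line, so its contribution to the defect operator `K` of `QvL_compV_eq`
carries the factor `Σ_{s<n}(n−1−s)·bump(s)·tilt(s) = 0` — the ZERO SPILL MOMENT the tilt was designed for (`VectorBlockTrialForm.spill_eq_zero`, p215424).
Hence, for EVERY family of coarse bond operators `Rc` (no unitarity, no smallness) and unitary site frames `U′`:
 * §1 **`Kdef_frameT_eq_zero`**: `Kdef n M (frameT n M U′ Rc) (U′⋆) φ = 0`, and **`QvL_frameT_compV`**: `QvL n M (frameT n M U′ Rc) (compV n M (U′⋆) φ) = φ` EXACTLY;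
 * §2 **`ScV_compV_frame_le`** ∕ **`exists_ubV_frame_ScV`** (rough-form readings `roughV_compV_frame_le` ∕ `exists_ubV_frame_rough` alongside):
   `∀ φ, ∃ W, QvL n M (frameT n M U′ Rc) W = φ ∧ ScV n M R G W ≤ lamV d (n·w) C_G (n²C₀) · nsqV M φ`
   — leaf V-UB for the carriers of record `Q₁ = QvL (frameT U′ Rc)` (the ones of leaf V-ONE-1F, p219670) with NO relative binder, NO finite dimension, constant
   `lamV` itself; binders: `U′` unitary, fine bond operators `‖R‖ ≤ 1` with the IN-BLOCK defect `‖R(x,ν)∘U′(x+e_ν)⋆∘U′(x) − 1‖ ≤ w` (the shape of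
   `VariationalColourPoincareLocal` ∕ `VariationalVectorOneStep` ∕ leaf-04-g4's `inBlock_defect_taxiTv_adjoint_le`), `1 ≤ d`, (GF1) `G ≤ C_G·rough + C₀·nsq`;
   `blockSpin_frame_le` is the `blockSpin` letter;
 * §3 THE NEAR-FRAME REPAIR: for GENERAL line transports `T` with `‖T(y,j,t,μ) − frameT(y,j,t,μ)‖ ≤ γ` (e.g. Bałaban's product transports at taxi frames,
   `γ = 3(d−1)L(L−1)a`, leaf-04-g4's `VariationalColourTaxiLines`), `Kdef T (U′⋆) = Kdef T̃ 1` with the shifted family `T̃ := 1 + (T − frameT)∘U′(p)⋆`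
   (`Kdef_eq_Kdef_shiftT`; `T̃` inline, no def), whose bond-indexed reference IS `1`; so part 2's `exists_corrected` applies verbatim and **`exists_ubV_nearFrame_ScV`** gives the
   END with `lamV ∕ (1 − κ⁻¹γ)²` (`[FiniteDimensional ℂ E]`, `κ⁻¹γ < 1`) — the frame-RELATIVE form of part 2 (rough form: `exists_ubV_nearFrame_rough`).
COORDINATION (journal 2026-08-20 ≈14:17Z): leaf-04-g4's parallel generic draft `VectorLineTransportUpperBoundFrame` was WITHDRAWN in favour of this file; the
TAXI-DATA instances (`U′ := taxiTv R`, `Rc := coarseTv R`, `T := lineT (taxiTv R) R`, `w = (d−1)(n−1)a`, `γ = 3(d−1)n(n−1)a`) are leaf-04-g4's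
`VariationalVectorTaxiUpperBound` ∕ `VariationalVectorTaxiOneStep`, consuming `exists_ubV_nearFrame_ScV` (binder `hT`) and `exists_ubV_frame_ScV` BY NAME.

HONEST FRAMING (T4-DAG p. 1).  Model level: `E`-valued 1-forms on a finite torus; frames `U′`, coarse ∕ fine bond operators `Rc` ∕ `R`, line transports `T`
are DATA (c5: no identification with Bałaban's `U(Γ)`); [folklore] lattice bookkeeping on this lineage's carriers; nothing printed is a hypothesis;
NO `def` (the shifted family `T̃` of §3 is written inline), no `def … : Prop`, no `sorry`; axioms standard.  Leaf V-UB only — nothing of V-GF ∕ V-P ∕ V-CURV ∕ V-ONE.  NE2 NOT proved on either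
road; NE3 OPEN; spine PROVED 0∕9; rung (B)+1 finite T⁴ — NOT infinite volume, NOT mass gap, NOT Clay.  HONEST DEPENDENCY (cell, verbatim): continuum YM
on T⁴ ⇐ BetaPertH ∧ nine spine estimates (0/9 proved); BetaPertH ⇐ (D1) ∧ (D4) ∧ CAP+tail; G-an2-4 gates asym, D1 and NE2/3/4.
-/

noncomputable section

namespace Summit.QuantumFields.BalabanUV.T4Continuum.VectorBlockTrialForm

open Finset
open Literature.MathematicalPhysics.QuantumFieldTheory.Balaban1983to89
open Literature.MathematicalPhysics.QuantumFieldTheory.Balaban1983to89.B5Prop11Plancherel (Tor fine unitVec)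
open Literature.MathematicalPhysics.QuantumFieldTheory.Balaban1983to89.B5Block118 (tstep bpt)
open Summit.QuantumFields.BalabanUV.T4Continuum.ScalarBlockTrialFunction (bump)
open Summit.QuantumFields.BalabanUV.T4Continuum.VariationalTransfer (blockSpin blockSpin_le)
open Summit.QuantumFields.BalabanUV.T4Continuum.VariationalColourFederbush (norm_le_one_of_mem_unitary)
open Summit.QuantumFields.BalabanUV.T4Continuum.VariationalVectorForm (ScV lamV lamV_nonneg ScV_compV_le ScV_nonneg)
open Summit.QuantumFields.BalabanUV.T4Continuum.VariationalVectorInterpolant (frameT)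

variable {d : ℕ} (n : ℕ) [NeZero n] (M : Fin d → ℕ) [hM : ∀ μ, NeZero (M μ)]
variable {E : Type*} [NormedAddCommGroup E] [InnerProductSpace ℂ E] [CompleteSpace E]

/-! ## §1 The defect operator vanishes at frame-adapted data -/

omit [NeZero n] hM in
/-- unitary frames undo their adjoints: `U′(x)(U′(x)⋆ v) = v`. [folklore] -/
theorem frame_mul_star_apply {U' : Tor (fine n M) → (E →L[ℂ] E)} (hU : ∀ x, U' x ∈ unitary (E →L[ℂ] E)) (x : Tor (fine n M)) (v : E) :
    U' x (star (U' x) v) = v := by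
  have h := Unitary.mul_star_self_of_mem (hU x)
  rw [← mul_apply_eq_comp, h, one_apply_eq_self]

/-- **THE DEFECT OPERATOR VANISHES AT FRAME-ADAPTED DATA**: `Kdef n M (frameT n M U′ Rc) (U′⋆) φ = 0` for unitary frames `U′` and ANY coarse bond operators
`Rc` — own-block points give `U′U′⋆ − 1 = 0`, spill points the CONSTANT `Rc(y,μ) − 1` against the zero spill moment `Σ_s(n−1−s)b(s)a(s) = 0`. [folklore] -/
theorem Kdef_frameT_eq_zero {U' : Tor (fine n M) → (E →L[ℂ] E)} (hU : ∀ x, U' x ∈ unitary (E →L[ℂ] E))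
    (Rc : Tor M → Fin d → (E →L[ℂ] E)) (φ : Tor M → Fin d → E) :
    Kdef n M (frameT n M U' Rc) (fun x _ => star (U' x)) φ = 0 := by
  funext y μ
  have hn : 0 < n := Nat.pos_of_ne_zero (NeZero.ne n)
  unfold Kdef
  rw [Pi.zero_apply, Pi.zero_apply]
  refine smul_eq_zero_of_right _ ?_
  rw [← (Equiv.funSplitAt μ (Fin n)).symm.sum_comp, Fintype.sum_prod_type, Finset.sum_comm]
  refine Finset.sum_eq_zero fun q _ => ?_
  -- per transverse fibre `q`
  set j₀ : Fin d → Fin n := (Equiv.funSplitAt μ (Fin n)).symm (0, q) with hj₀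
  have hj : j₀ μ = 0 := (funSplitAt_symm_eq n μ 0 q).2
  set h : ℕ → E := fun s => if n ≤ s then (Rc y μ - 1) (trialV n M φ (bpt n M y j₀ + tstep (fine n M) μ s) μ) else 0 with hh
  have step1 : ∑ i : Fin n, ∑ t : Fin n,
      (frameT n M U' Rc y ((Equiv.funSplitAt μ (Fin n)).symm (i, q)) t μ
          * star (U' (bpt n M y ((Equiv.funSplitAt μ (Fin n)).symm (i, q)) + tstep (fine n M) μ t)) - 1)
        (trialV n M φ (bpt n M y ((Equiv.funSplitAt μ (Fin n)).symm (i, q)) + tstep (fine n M) μ t) μ)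
      = ∑ i ∈ range n, ∑ t ∈ range n, h (i + t) := by
    rw [Finset.sum_range (fun i => ∑ t ∈ range n, h (i + t))]
    refine Fintype.sum_congr _ _ fun i => ?_
    rw [Finset.sum_range (fun t => h (i + t))]
    refine Fintype.sum_congr _ _ fun t => ?_
    rw [(funSplitAt_symm_eq n μ i q).1, hh]
    simp only
    rw [tstep_add, ← add_assoc, line_point_lt n M y hj i i.is_lt]
    unfold frameT
    rw [Function.update_self]
    by_cases hlt : (i : ℕ) + (t : ℕ) < n
    · rw [if_pos hlt, if_neg (not_le.mpr hlt), Unitary.mul_star_self_of_mem (hU _), sub_self, zero_apply]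
    · rw [if_neg hlt, if_pos (not_lt.mp hlt), mul_assoc, Unitary.mul_star_self_of_mem (hU _), mul_one]
  have step2 : ∑ i ∈ range n, ∑ t ∈ range n, h (i + t) = 0 := by
    rw [sum_window]
    have hown : ∑ s ∈ range n, (s + 1) • h s = 0 := by
      refine sum_eq_zero fun s hs => ?_
      rw [mem_range] at hs
      rw [hh]; simp only
      rw [if_neg (not_le.mpr hs), smul_zero]
    have hspill : ∑ s ∈ range n, (n - 1 - s) • h (n + s) = 0 := by
      set Rq : ℝ := ∏ ν ∈ univ.erase μ, bump n (j₀ ν) with hRq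
      have hterm : ∀ s ∈ range n, (n - 1 - s) • h (n + s)
          = (Rc y μ - 1) (((((n : ℝ) - 1 - s) * bump n s * tilt n s * Rq : ℝ) : ℂ) • φ (y + unitVec M μ) μ) := by
        intro s hs
        rw [mem_range] at hs
        have hc : ((n - 1 - s : ℕ) : ℝ) = (n : ℝ) - 1 - s := by
          have e : (n - 1 - s) + s + 1 = n := by omega
          have e' := congrArg (Nat.cast : ℕ → ℝ) e
          push_cast at e'
          linarith
        rw [hh]; simp only
        rw [if_pos (Nat.le_add_right n s), trialV_line_ge n M φ y hj s hs, ← hRq, ← map_nsmul, ← Nat.cast_smul_eq_nsmul ℂ, smul_smul,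
          ← Complex.ofReal_natCast, ← Complex.ofReal_mul, hc]
        congr 3
        ring
      rw [sum_congr rfl hterm, ← map_sum, ← Finset.sum_smul, ← Complex.ofReal_sum]
      have hz : ∑ s ∈ range n, ((n : ℝ) - 1 - s) * bump n s * tilt n s * Rq = 0 := by
        rw [← Finset.sum_mul, spill_eq_zero hn, zero_mul]
      rw [hz, Complex.ofReal_zero, zero_smul, map_zero]
    rw [hown, hspill, add_zero]
  rw [step1, step2]

/-- **THE CONSTRAINT, EXACTLY, FOR THE TILTED TRIAL 1-FORM UNDER FRAME-ADAPTED LINE TRANSPORTS**: `QvL n M (frameT n M U′ Rc) (compV n M (U′⋆) φ) = φ`. [folklore] -/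
theorem QvL_frameT_compV {U' : Tor (fine n M) → (E →L[ℂ] E)} (hU : ∀ x, U' x ∈ unitary (E →L[ℂ] E))
    (Rc : Tor M → Fin d → (E →L[ℂ] E)) (φ : Tor M → Fin d → E) :
    QvL n M (frameT n M U' Rc) (compV n M (fun x _ => star (U' x)) φ) = φ := by
  funext y μ
  rw [QvL_compV_eq, Kdef_frameT_eq_zero n M hU Rc φ, Pi.zero_apply, Pi.zero_apply, add_zero]

/-! ## §2 Leaf V-UB for the carriers of record `Q₁ = QvL (frameT U′ Rc)` — no relative binder -/

/-- **THE ENERGY HALF AT FRAME DATA**: `ScV n M R G (compV n M (U′⋆) φ) ≤ lamV d (n·w) C_G (n²C₀) · nsqV M φ` — the road owner's `ScV_compV_le` at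
`(Tl, Sl) := (U′, U′⋆)`, the only transport binder left being the IN-BLOCK defect `‖R(x,ν)∘U′(x+e_ν)⋆∘U′(x) − 1‖ ≤ w`. [folklore] -/
theorem ScV_compV_frame_le {U' : Tor (fine n M) → (E →L[ℂ] E)} (hU : ∀ x, U' x ∈ unitary (E →L[ℂ] E))
    {R : Tor (fine n M) → Fin d → (E →L[ℂ] E)} (hR : ∀ x ν, ‖R x ν‖ ≤ 1) {w : ℝ} (hw0 : 0 ≤ w)
    (hw : ∀ (y : Tor M) (j : Fin d → Fin n) (ν : Fin d), (j ν : ℕ) + 1 < n →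
      ‖R (bpt n M y j) ν * star (U' (bpt n M y j + unitVec (fine n M) ν)) * U' (bpt n M y j) - 1‖ ≤ w)
    (hd : 1 ≤ d) {G : (Tor (fine n M) → Fin d → E) → ℝ} {CG C₀ : ℝ} (hCG : 0 ≤ CG) (hC₀ : 0 ≤ C₀)
    (hG : ∀ W, G W ≤ CG * roughV n M R W + C₀ * nsqV (fine n M) W) (φ : Tor M → Fin d → E) :
    ScV n M R G (compV n M (fun x _ => star (U' x)) φ) ≤ lamV d (n * w) CG ((n : ℝ) ^ 2 * C₀) * nsqV M φ :=
  ScV_compV_le n M (Tl := fun x _ => U' x) (Sl := fun x _ => star (U' x)) (fun x _ v => frame_mul_star_apply n M hU x v)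
    (fun x _ => norm_le_one_of_mem_unitary (hU x)) (fun x _ => norm_le_one_of_mem_unitary (Unitary.star_mem (hU x))) hR hw0
    (fun y j ν _ hlt => hw y j ν hlt) hd hCG hC₀ hG φ

/-- **THE ROUGH-FORM READING AT FRAME DATA**: `n^{−d}·n²·roughV R (compV (U′⋆) φ) ≤ 2d·(60·6^{d−1})²·((2 + n·w)² + 9)·nsqV M φ` — this lineage's
`physRoughV_compV_le` (p215552) at `(Tl, Sl) := (U′, U′⋆)`. [folklore] -/
theorem roughV_compV_frame_le {U' : Tor (fine n M) → (E →L[ℂ] E)} (hU : ∀ x, U' x ∈ unitary (E →L[ℂ] E))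
    {R : Tor (fine n M) → Fin d → (E →L[ℂ] E)} (hR : ∀ x ν, ‖R x ν‖ ≤ 1) {w : ℝ} (hw0 : 0 ≤ w)
    (hw : ∀ (y : Tor M) (j : Fin d → Fin n) (ν : Fin d), (j ν : ℕ) + 1 < n →
      ‖R (bpt n M y j) ν * star (U' (bpt n M y j + unitVec (fine n M) ν)) * U' (bpt n M y j) - 1‖ ≤ w)
    (hd : 1 ≤ d) (φ : Tor M → Fin d → E) :
    ((n : ℝ) ^ d)⁻¹ * ((n : ℝ) ^ 2 * roughV n M R (compV n M (fun x _ => star (U' x)) φ))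
      ≤ 2 * d * (60 * (6 : ℝ) ^ (d - 1)) ^ 2 * ((2 + n * w) ^ 2 + 9) * nsqV M φ :=
  physRoughV_compV_le n M (Tl := fun x _ => U' x) (Sl := fun x _ => star (U' x)) (fun x _ v => frame_mul_star_apply n M hU x v)
    (fun x _ => norm_le_one_of_mem_unitary (hU x)) (fun x _ => norm_le_one_of_mem_unitary (Unitary.star_mem (hU x))) hR hw0
    (fun y j ν _ hlt => hw y j ν hlt) hd φ

/-- **LEAF V-UB AT FRAME-ADAPTED DATA, ROUGH FORM**: `∀ φ, ∃ W, QvL n M (frameT n M U′ Rc) W = φ ∧ n^{−d}n²·roughV R W ≤ 2d(60·6^{d−1})²((2 + n·w)² + 9)·nsqV M φ`. [folklore] -/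
theorem exists_ubV_frame_rough {U' : Tor (fine n M) → (E →L[ℂ] E)} (hU : ∀ x, U' x ∈ unitary (E →L[ℂ] E))
    (Rc : Tor M → Fin d → (E →L[ℂ] E)) {R : Tor (fine n M) → Fin d → (E →L[ℂ] E)} (hR : ∀ x ν, ‖R x ν‖ ≤ 1) {w : ℝ} (hw0 : 0 ≤ w)
    (hw : ∀ (y : Tor M) (j : Fin d → Fin n) (ν : Fin d), (j ν : ℕ) + 1 < n →
      ‖R (bpt n M y j) ν * star (U' (bpt n M y j + unitVec (fine n M) ν)) * U' (bpt n M y j) - 1‖ ≤ w)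
    (hd : 1 ≤ d) :
    ∀ φ : Tor M → Fin d → E, ∃ W : Tor (fine n M) → Fin d → E, QvL n M (frameT n M U' Rc) W = φ ∧
      ((n : ℝ) ^ d)⁻¹ * ((n : ℝ) ^ 2 * roughV n M R W) ≤ 2 * d * (60 * (6 : ℝ) ^ (d - 1)) ^ 2 * ((2 + n * w) ^ 2 + 9) * nsqV M φ :=
  fun φ => ⟨compV n M (fun x _ => star (U' x)) φ, QvL_frameT_compV n M hU Rc φ, roughV_compV_frame_le n M hU hR hw0 hw hd φ⟩

/-- **LEAF V-UB AT FRAME-ADAPTED DATA, `∃`-form (the `hUBc` shape)**: for unitary frames `U′`, ANY coarse bond operators `Rc`, fine bond operators `‖R‖ ≤ 1`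
with in-block defect `w`, and (GF1): `∀ φ, ∃ W, QvL n M (frameT n M U′ Rc) W = φ ∧ ScV n M R G W ≤ lamV d (n·w) C_G (n²C₀) · nsqV M φ` — NO relative-operator
binder, NO finite dimension, the constant `lamV` itself. [folklore] -/
theorem exists_ubV_frame_ScV {U' : Tor (fine n M) → (E →L[ℂ] E)} (hU : ∀ x, U' x ∈ unitary (E →L[ℂ] E))
    (Rc : Tor M → Fin d → (E →L[ℂ] E)) {R : Tor (fine n M) → Fin d → (E →L[ℂ] E)} (hR : ∀ x ν, ‖R x ν‖ ≤ 1) {w : ℝ} (hw0 : 0 ≤ w)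
    (hw : ∀ (y : Tor M) (j : Fin d → Fin n) (ν : Fin d), (j ν : ℕ) + 1 < n →
      ‖R (bpt n M y j) ν * star (U' (bpt n M y j + unitVec (fine n M) ν)) * U' (bpt n M y j) - 1‖ ≤ w)
    (hd : 1 ≤ d) {G : (Tor (fine n M) → Fin d → E) → ℝ} {CG C₀ : ℝ} (hCG : 0 ≤ CG) (hC₀ : 0 ≤ C₀)
    (hG : ∀ W, G W ≤ CG * roughV n M R W + C₀ * nsqV (fine n M) W) :
    ∀ φ : Tor M → Fin d → E, ∃ W : Tor (fine n M) → Fin d → E, QvL n M (frameT n M U' Rc) W = φ ∧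
      ScV n M R G W ≤ lamV d (n * w) CG ((n : ℝ) ^ 2 * C₀) * nsqV M φ :=
  fun φ => ⟨compV n M (fun x _ => star (U' x)) φ, QvL_frameT_compV n M hU Rc φ, ScV_compV_frame_le n M hU hR hw0 hw hd hCG hC₀ hG φ⟩

/-- **LEAF V-UB AT FRAME-ADAPTED DATA, `blockSpin` letter**: `blockSpin (QvL (frameT U′ Rc)) (ScV R G) φ ≤ lamV d (n·w) C_G (n²C₀) · nsqV M φ`
(for `G ≥ −curlSq∕2`-bounded-below forms, here `0 ≤ ScV` supplied by `hG0`). [folklore] -/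
theorem blockSpin_frame_le {U' : Tor (fine n M) → (E →L[ℂ] E)} (hU : ∀ x, U' x ∈ unitary (E →L[ℂ] E))
    (Rc : Tor M → Fin d → (E →L[ℂ] E)) {R : Tor (fine n M) → Fin d → (E →L[ℂ] E)} (hR : ∀ x ν, ‖R x ν‖ ≤ 1) {w : ℝ} (hw0 : 0 ≤ w)
    (hw : ∀ (y : Tor M) (j : Fin d → Fin n) (ν : Fin d), (j ν : ℕ) + 1 < n →
      ‖R (bpt n M y j) ν * star (U' (bpt n M y j + unitVec (fine n M) ν)) * U' (bpt n M y j) - 1‖ ≤ w)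
    (hd : 1 ≤ d) {G : (Tor (fine n M) → Fin d → E) → ℝ} (hG0 : ∀ W, 0 ≤ G W) {CG C₀ : ℝ} (hCG : 0 ≤ CG) (hC₀ : 0 ≤ C₀)
    (hG : ∀ W, G W ≤ CG * roughV n M R W + C₀ * nsqV (fine n M) W) (φ : Tor M → Fin d → E) :
    blockSpin (QvL n M (frameT n M U' Rc)) (ScV n M R G) φ ≤ lamV d (n * w) CG ((n : ℝ) ^ 2 * C₀) * nsqV M φ :=
  (blockSpin_le (ScV_nonneg n M R hG0) (QvL_frameT_compV n M hU Rc φ)).trans (ScV_compV_frame_le n M hU hR hw0 hw hd hCG hC₀ hG φ)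

/-- ROUND TRIP (non-vacuity, kernel): at trivial frames `U′ = 1`, flat fine bond operators `R = 1` (in-block defect `w = 0`) and the ROUGH form (`G = 0`),
the END holds for EVERY family of coarse bond operators `Rc` with no hypothesis left but `1 ≤ d`. -/
example (hd : 1 ≤ d) (Rc : Tor M → Fin d → (E →L[ℂ] E)) (φ : Tor M → Fin d → E) :
    ∃ W : Tor (fine n M) → Fin d → E, QvL n M (frameT n M (fun _ => (1 : E →L[ℂ] E)) Rc) W = φ ∧
      ScV n M (fun _ _ => (1 : E →L[ℂ] E)) (fun _ => 0) W ≤ lamV d (n * 0) 0 ((n : ℝ) ^ 2 * 0) * nsqV M φ :=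
  exists_ubV_frame_ScV n M (U' := fun _ => 1) (fun _ => Submonoid.one_mem _) Rc (R := fun _ _ => 1) (fun _ _ => ContinuousLinearMap.norm_id_le) le_rfl
    (fun y j ν _ => by simp) hd le_rfl le_rfl (fun W => by simp) φ

/-! ## §3 The near-frame repair: general line transports `‖T − frameT‖ ≤ γ` -/

/-- **THE DEFECT OPERATOR OF `T` AGAINST THE FRAMES IS THAT OF THE SHIFTED FAMILY AGAINST `1`**: with `T̃(y,j,t,μ) := 1 + (T − frameT U′ Rc)(y,j,t,μ)∘U′(p)⋆`,
`p = n·y + j + t e_μ` (written inline, no def), `Kdef T (U′⋆) = Kdef T̃ 1` — by §1 the frame part drops out. [folklore] -/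
theorem Kdef_eq_Kdef_shiftT {U' : Tor (fine n M) → (E →L[ℂ] E)} (hU : ∀ x, U' x ∈ unitary (E →L[ℂ] E))
    (Rc : Tor M → Fin d → (E →L[ℂ] E)) (T : Tor M → (Fin d → Fin n) → Fin n → Fin d → (E →L[ℂ] E)) (φ : Tor M → Fin d → E) :
    Kdef n M T (fun x _ => star (U' x)) φ = Kdef n M (fun y j t μ => 1 + (T y j t μ - frameT n M U' Rc y j t μ) * star (U' (bpt n M y j + tstep (fine n M) μ t))) (fun _ _ => 1) φ := by
  funext y μ
  have h0 : Kdef n M (frameT n M U' Rc) (fun x _ => star (U' x)) φ y μ = 0 := by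
    rw [Kdef_frameT_eq_zero n M hU Rc φ]; rfl
  symm
  rw [← sub_zero (Kdef n M T (fun x _ => star (U' x)) φ y μ), ← h0]
  unfold Kdef
  rw [← smul_sub, ← sum_sub_distrib]
  congr 1
  refine sum_congr rfl fun j _ => ?_
  rw [← sum_sub_distrib]
  refine sum_congr rfl fun t _ => ?_
  rw [← sub_apply]
  congr 1
  simp only [mul_one, sub_mul]
  abel

omit [NeZero n] hM in
/-- the shifted family meets the bond-indexed relative binder of part 2 with reference `1`: `‖T̃·1 − 1‖ ≤ γ` once `‖T − frameT‖ ≤ γ`. [folklore] -/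
theorem shiftT_rel_le {U' : Tor (fine n M) → (E →L[ℂ] E)} (hU : ∀ x, U' x ∈ unitary (E →L[ℂ] E))
    {Rc : Tor M → Fin d → (E →L[ℂ] E)} {T : Tor M → (Fin d → Fin n) → Fin n → Fin d → (E →L[ℂ] E)} {γ : ℝ}
    (hT : ∀ y j t μ, ‖T y j t μ - frameT n M U' Rc y j t μ‖ ≤ γ) (y : Tor M) (j : Fin d → Fin n) (t : Fin n) (μ : Fin d) :
    ‖(fun y j t μ => 1 + (T y j t μ - frameT n M U' Rc y j t μ) * star (U' (bpt n M y j + tstep (fine n M) μ t))) y j t μ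
        * (fun _ _ => (1 : E →L[ℂ] E)) (bpt n M y j + tstep (fine n M) μ t) μ - 1‖ ≤ γ := by
  simp only [mul_one, add_sub_cancel_left]
  refine (norm_mul_le _ _).trans ?_
  calc ‖T y j t μ - frameT n M U' Rc y j t μ‖ * ‖star (U' (bpt n M y j + tstep (fine n M) μ t))‖
      ≤ γ * 1 := mul_le_mul (hT y j t μ) (norm_le_one_of_mem_unitary (Unitary.star_mem (hU _))) (norm_nonneg _)
          ((norm_nonneg _).trans (hT y j t μ))
    _ = γ := mul_one γ

/-- **LEAF V-UB NEAR FRAME-ADAPTED DATA (`hUBc` shape)**: for general line transports `T` with `‖T(y,j,t,μ) − frameT U′ Rc(y,j,t,μ)‖ ≤ γ`, `κ⁻¹γ < 1`, finite-dimensional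
`E`: `∀ φ, ∃ W, QvL n M T W = φ ∧ ScV n M R G W ≤ lamV d (n·w) C_G (n²C₀) ∕ (1 − κ⁻¹γ)² · nsqV M φ` — part 2's `exists_corrected` on the shifted family. [folklore] -/
theorem exists_ubV_nearFrame_ScV [FiniteDimensional ℂ E] {U' : Tor (fine n M) → (E →L[ℂ] E)} (hU : ∀ x, U' x ∈ unitary (E →L[ℂ] E))
    {Rc : Tor M → Fin d → (E →L[ℂ] E)} {T : Tor M → (Fin d → Fin n) → Fin n → Fin d → (E →L[ℂ] E)} {γ : ℝ}
    (hT : ∀ y j t μ, ‖T y j t μ - frameT n M U' Rc y j t μ‖ ≤ γ) (hc : (kappaV d n)⁻¹ * γ < 1)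
    {R : Tor (fine n M) → Fin d → (E →L[ℂ] E)} (hR : ∀ x ν, ‖R x ν‖ ≤ 1) {w : ℝ} (hw0 : 0 ≤ w)
    (hw : ∀ (y : Tor M) (j : Fin d → Fin n) (ν : Fin d), (j ν : ℕ) + 1 < n →
      ‖R (bpt n M y j) ν * star (U' (bpt n M y j + unitVec (fine n M) ν)) * U' (bpt n M y j) - 1‖ ≤ w)
    (hd : 1 ≤ d) {G : (Tor (fine n M) → Fin d → E) → ℝ} {CG C₀ : ℝ} (hCG : 0 ≤ CG) (hC₀ : 0 ≤ C₀)
    (hG : ∀ W, G W ≤ CG * roughV n M R W + C₀ * nsqV (fine n M) W) :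
    ∀ φ : Tor M → Fin d → E, ∃ W : Tor (fine n M) → Fin d → E, QvL n M T W = φ ∧
      ScV n M R G W ≤ lamV d (n * w) CG ((n : ℝ) ^ 2 * C₀) / (1 - (kappaV d n)⁻¹ * γ) ^ 2 * nsqV M φ := by
  intro φ
  obtain ⟨φ', hφ', hb⟩ := exists_corrected n M
    (T := (fun y j t μ => 1 + (T y j t μ - frameT n M U' Rc y j t μ) * star (U' (bpt n M y j + tstep (fine n M) μ t)))) (S₀ := fun _ _ => 1) (shiftT_rel_le n M hU hT) hd hc φ
  refine ⟨compV n M (fun x _ => star (U' x)) φ', ?_, ?_⟩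
  · funext y μ
    rw [QvL_compV_eq, Kdef_eq_Kdef_shiftT n M hU Rc T φ', ← hφ']
    rfl
  · have hE := ScV_compV_frame_le n M hU hR hw0 hw hd hCG hC₀ hG φ'
    have hΛ : 0 ≤ lamV d (n * w) CG ((n : ℝ) ^ 2 * C₀) := lamV_nonneg hCG (by positivity)
    calc _ ≤ lamV d (n * w) CG ((n : ℝ) ^ 2 * C₀) * nsqV M φ' := hE
      _ ≤ lamV d (n * w) CG ((n : ℝ) ^ 2 * C₀) * (nsqV M φ / (1 - (kappaV d n)⁻¹ * γ) ^ 2) := mul_le_mul_of_nonneg_left hb hΛ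
      _ = _ := by ring

/-- **LEAF V-UB NEAR FRAME-ADAPTED DATA, ROUGH FORM**: under the same near-frame binder,
`∀ φ, ∃ W, QvL n M T W = φ ∧ n^{−d}n²·roughV R W ≤ 2d(60·6^{d−1})²((2 + n·w)² + 9) ∕ (1 − κ⁻¹γ)² · nsqV M φ`. [folklore] -/
theorem exists_ubV_nearFrame_rough [FiniteDimensional ℂ E] {U' : Tor (fine n M) → (E →L[ℂ] E)} (hU : ∀ x, U' x ∈ unitary (E →L[ℂ] E))
    {Rc : Tor M → Fin d → (E →L[ℂ] E)} {T : Tor M → (Fin d → Fin n) → Fin n → Fin d → (E →L[ℂ] E)} {γ : ℝ}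
    (hT : ∀ y j t μ, ‖T y j t μ - frameT n M U' Rc y j t μ‖ ≤ γ) (hc : (kappaV d n)⁻¹ * γ < 1)
    {R : Tor (fine n M) → Fin d → (E →L[ℂ] E)} (hR : ∀ x ν, ‖R x ν‖ ≤ 1) {w : ℝ} (hw0 : 0 ≤ w)
    (hw : ∀ (y : Tor M) (j : Fin d → Fin n) (ν : Fin d), (j ν : ℕ) + 1 < n →
      ‖R (bpt n M y j) ν * star (U' (bpt n M y j + unitVec (fine n M) ν)) * U' (bpt n M y j) - 1‖ ≤ w)
    (hd : 1 ≤ d) :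
    ∀ φ : Tor M → Fin d → E, ∃ W : Tor (fine n M) → Fin d → E, QvL n M T W = φ ∧
      ((n : ℝ) ^ d)⁻¹ * ((n : ℝ) ^ 2 * roughV n M R W)
        ≤ 2 * d * (60 * (6 : ℝ) ^ (d - 1)) ^ 2 * ((2 + n * w) ^ 2 + 9) / (1 - (kappaV d n)⁻¹ * γ) ^ 2 * nsqV M φ := by
  intro φ
  obtain ⟨φ', hφ', hb⟩ := exists_corrected n M
    (T := (fun y j t μ => 1 + (T y j t μ - frameT n M U' Rc y j t μ) * star (U' (bpt n M y j + tstep (fine n M) μ t)))) (S₀ := fun _ _ => 1) (shiftT_rel_le n M hU hT) hd hc φ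
  refine ⟨compV n M (fun x _ => star (U' x)) φ', ?_, ?_⟩
  · funext y μ
    rw [QvL_compV_eq, Kdef_eq_Kdef_shiftT n M hU Rc T φ', ← hφ']
    rfl
  · have hE := roughV_compV_frame_le n M hU hR hw0 hw hd φ'
    have hΛ : 0 ≤ 2 * d * (60 * (6 : ℝ) ^ (d - 1)) ^ 2 * ((2 + n * w) ^ 2 + 9) := by positivity
    calc _ ≤ 2 * d * (60 * (6 : ℝ) ^ (d - 1)) ^ 2 * ((2 + n * w) ^ 2 + 9) * nsqV M φ' := hE
      _ ≤ 2 * d * (60 * (6 : ℝ) ^ (d - 1)) ^ 2 * ((2 + n * w) ^ 2 + 9) * (nsqV M φ / (1 - (kappaV d n)⁻¹ * γ) ^ 2) :=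
          mul_le_mul_of_nonneg_left hb hΛ
      _ = _ := by ring

end Summit.QuantumFields.BalabanUV.T4Continuum.VectorBlockTrialForm

end
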